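import Literature.NumberTheory.Sieve.AsymptoticSieveForPrimesReduction
import HarnessLib

/-!
# Asymptotic sieve for primes: the reduced bilinear bound (B′) with the saving it carries (proof)

Trunk T-SIEVE. Source: J. Friedlander, H. Iwaniec, *Asymptotic sieve for primes*, Ann. of Math. 148
(1998) 1041–1065 [FriedlanderIwaniecASP1998] (= arXiv:math/9811186), §2 "Technical reductions",
pp. 1046–1048: "(B′) `∑_m τ₅(m) |∑_{N<n≤2N, mn≤x} γ(n)μ(mn)a_{mn}| ≪ A(x)(log x)^{-3}` in the same
notation and ranges as in (R) and (B) … Finally (R′) follows from (R) and (2.3) by Hölder's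
inequality. The derivation of (B′) from (B) is similar."

FI print (B′) with the saving `(log x)^{-3}` ("What we actually need for the proof of Theorem 1"),
but the printed hypothesis (B) (p. 1043) carries the saving `(log x)^{-2^{22}}`, and the Hölder
step of p. 1047 (`(B′) ≤ (B)^{1/4} · (2.1)-type sum^{3/4}`, the latter `≪ A(x)(log x)^{2^{20}}`)
yields (B′) with ANY saving `(log x)^{-k}`, `k ≤ 2^{18}`. The uses of (B′) in §7 ((7.1)–(7.2):
a factor `log x` from `∑_{c ∣ k} Λ(c)`, an integration `∫_{Y/Δ}^{eY} dy/y = 1 + log Δ` and `log₂ s`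
dyadic pieces, each `≍ log x` when `Δ = x^η`) need `k ≥ 5` to produce `S₂(x; Y, z) ≪ A(x)(log x)^{-1}`;
this file therefore records the stronger form that the printed derivation gives:
`SieveSequence.FIAsymptoticSieveHypotheses.reduced_bilinear_bound_pow` — under the hypotheses of
Theorem 1, for every `k ≤ 2^{18}`, `∑_m τ₅(m)|∑_{N<n≤2N, mn≤x} γ(n; C)μ(mn)a_{mn}| ≤ K A(x)(log x)^{-k}`
for all large `x`, all `N` in (B1) and `C` in (B3). The proof is that of
`Literature.NumberTheory.Sieve.fi_reduced_bilinear_bound_holds` (`…Reduction`) verbatim, with the numerical tail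
`holder_tail_le` replaced by `holder_tail_le_pow`.

## Mathlib search

The tree: `Literature.NumberTheory.Sieve.holder_tail_le`, `Literature.NumberTheory.Sieve.SieveSequence.sum_divisorCountK_five_mul_le_holder`,
`Literature.NumberTheory.Sieve.sum_sum_le_sum_divisorsAntidiagonal`, `Literature.NumberTheory.Sieve.sum_divisorsAntidiagonal_nine_pow_mul_card_divisors_le`,
`Literature.NumberTheory.Sieve.SieveSequence.FIAsymptoticSieveHypotheses.sum_a_mul_card_divisors_pow_four_le`
(`Literature.NumberTheory.Sieve.AsymptoticSieveForPrimesReduction`); nothing else on (B′)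
(`lean search 'reduced_bilinear'`).
-/

noncomputable section

open Filter Finset
open scoped ArithmeticFunction.Moebius ArithmeticFunction.sigma ArithmeticFunction.omega

namespace Literature.NumberTheory.Sieve

/-- The numerical tail of the Hölder step with the full saving: if `R₀ ≤ A L^{-2^{22}}` and
`R₁ ≤ C₁ A L^{2^{20}}` with `L ≥ 1`, `A, C₁, R₀, R₁ ≥ 0`, then `R₀^{1/4} R₁^{3/4} ≤ (C₁ + 1) A / L^k`
for every `k ≤ 2^{18}`. [folklore] -/
theorem holder_tail_le_pow {R₀ R₁ Asz L C₁ : ℝ} {k : ℕ} (hk : k ≤ 2 ^ 18) (hA0 : 0 ≤ Asz)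
    (hL1 : 1 ≤ L) (hC₁0 : 0 ≤ C₁) (hr0 : 0 ≤ R₀) (hr1 : 0 ≤ R₁)
    (hR0 : R₀ ≤ Asz * L ^ (-(2 ^ 22 : ℝ))) (hR1 : R₁ ≤ C₁ * Asz * L ^ (2 ^ 20 : ℝ)) :
    R₀ ^ (1 / 4 : ℝ) * R₁ ^ (3 / 4 : ℝ) ≤ (C₁ + 1) * Asz / L ^ k := by
  have hL0 : 0 < L := by linarith
  have hLneg : 0 ≤ L ^ (-(2 ^ 22 : ℝ)) := Real.rpow_nonneg hL0.le _
  have hR0' : R₀ ^ (1 / 4 : ℝ) ≤ (Asz * L ^ (-(2 ^ 22 : ℝ))) ^ (1 / 4 : ℝ) :=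
    Real.rpow_le_rpow hr0 hR0 (by norm_num)
  have hR1' : R₁ ^ (3 / 4 : ℝ) ≤ (C₁ * Asz * L ^ (2 ^ 20 : ℝ)) ^ (3 / 4 : ℝ) :=
    Real.rpow_le_rpow hr1 hR1 (by norm_num)
  have hprod : (Asz * L ^ (-(2 ^ 22 : ℝ))) ^ (1 / 4 : ℝ) *
      (C₁ * Asz * L ^ (2 ^ 20 : ℝ)) ^ (3 / 4 : ℝ) = C₁ ^ (3 / 4 : ℝ) * Asz * L ^ (-(2 ^ 18 : ℝ)) := by
    rw [Real.mul_rpow hA0 hLneg, Real.mul_rpow (mul_nonneg hC₁0 hA0) (Real.rpow_nonneg hL0.le _),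
      Real.mul_rpow hC₁0 hA0, ← Real.rpow_mul hL0.le, ← Real.rpow_mul hL0.le]
    have hA : Asz ^ (1 / 4 : ℝ) * Asz ^ (3 / 4 : ℝ) = Asz := by
      rw [← Real.rpow_add' hA0 (by norm_num)]; norm_num
    have hLL : L ^ (-(2 ^ 22 : ℝ) * (1 / 4)) * L ^ ((2 ^ 20 : ℝ) * (3 / 4)) = L ^ (-(2 ^ 18 : ℝ)) := by
      rw [← Real.rpow_add hL0]; norm_num
    calc Asz ^ (1 / 4 : ℝ) * L ^ (-(2 ^ 22 : ℝ) * (1 / 4)) *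
          (C₁ ^ (3 / 4 : ℝ) * Asz ^ (3 / 4 : ℝ) * L ^ ((2 ^ 20 : ℝ) * (3 / 4)))
        = C₁ ^ (3 / 4 : ℝ) * (Asz ^ (1 / 4 : ℝ) * Asz ^ (3 / 4 : ℝ)) *
            (L ^ (-(2 ^ 22 : ℝ) * (1 / 4)) * L ^ ((2 ^ 20 : ℝ) * (3 / 4))) := by ring
      _ = C₁ ^ (3 / 4 : ℝ) * Asz * L ^ (-(2 ^ 18 : ℝ)) := by rw [hA, hLL]
  have hC34 : C₁ ^ (3 / 4 : ℝ) ≤ C₁ + 1 := by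
    rcases le_or_gt 1 C₁ with h1 | h1
    · calc C₁ ^ (3 / 4 : ℝ) ≤ C₁ ^ (1 : ℝ) := Real.rpow_le_rpow_of_exponent_le h1 (by norm_num)
        _ = C₁ := Real.rpow_one _
        _ ≤ C₁ + 1 := by linarith
    · have : C₁ ^ (3 / 4 : ℝ) ≤ 1 := Real.rpow_le_one hC₁0 h1.le (by norm_num)
      linarith
  have hk' : ((k : ℕ) : ℝ) ≤ 2 ^ 18 := by exact_mod_cast hk
  have hL18 : L ^ (-(2 ^ 18 : ℝ)) ≤ (L ^ k)⁻¹ := by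
    calc L ^ (-(2 ^ 18 : ℝ)) ≤ L ^ (-(k : ℝ)) :=
          Real.rpow_le_rpow_of_exponent_le hL1 (by linarith)
      _ = (L ^ k)⁻¹ := by rw [Real.rpow_neg hL0.le, Real.rpow_natCast]
  calc R₀ ^ (1 / 4 : ℝ) * R₁ ^ (3 / 4 : ℝ)
      ≤ (Asz * L ^ (-(2 ^ 22 : ℝ))) ^ (1 / 4 : ℝ) * (C₁ * Asz * L ^ (2 ^ 20 : ℝ)) ^ (3 / 4 : ℝ) :=
        mul_le_mul hR0' hR1' (Real.rpow_nonneg hr1 _) (Real.rpow_nonneg (mul_nonneg hA0 hLneg) _)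
    _ = C₁ ^ (3 / 4 : ℝ) * Asz * L ^ (-(2 ^ 18 : ℝ)) := hprod
    _ ≤ (C₁ + 1) * Asz * (L ^ k)⁻¹ :=
        mul_le_mul (mul_le_mul_of_nonneg_right hC34 hA0) hL18 (Real.rpow_nonneg hL0.le _)
          (by positivity)
    _ = (C₁ + 1) * Asz / L ^ k := by rw [div_eq_mul_inv]

variable {A : SieveSequence} {D δ Δ : ℝ → ℝ}

/-- **(B′) with the saving `(log x)^{-k}`, `k ≤ 2^{18}`** (FI §2 pp. 1046–1048: "The derivation of
(B′) from (B) is similar", i.e. from (B) [saving `(log x)^{-2^{22}}`, p. 1043], (1.6) and Lemma 1 by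
Hölder's inequality; the printed (B′) records only the exponent `3`). Under
`SieveSequence.FIAsymptoticSieveHypotheses A D δ Δ`: for every `k ≤ 2^{18}` there is `K` such that
for all large `x`, every `N` in (B1) `Δ⁻¹√D < N < δ⁻¹√x` and every `1 ≤ C ≤ x/D` (B3),
`∑_m τ₅(m) |∑_{N < n ≤ 2N, mn ≤ x} γ(n; C) μ(mn) a_{mn}| ≤ K A(x) (log x)^{-k}`.
[cite: FriedlanderIwaniecASP1998, §2 (B′)] -/
theorem SieveSequence.FIAsymptoticSieveHypotheses.reduced_bilinear_bound_pow
    (h : A.FIAsymptoticSieveHypotheses D δ Δ) {k : ℕ} (hk : k ≤ 2 ^ 18) :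
    ∃ K : ℝ, ∀ᶠ x : ℝ in atTop, ∀ N : ℝ, Real.sqrt (D x) / Δ x < N → N < Real.sqrt x / δ x →
      ∀ C : ℝ, 1 ≤ C → C ≤ x / D x →
        ∑ m ∈ Icc 1 ⌊x⌋₊, (divisorCountK 5 m : ℝ) *
          |∑ n ∈ (Ioc ⌊N⌋₊ ⌊2 * N⌋₊).filter (fun n : ℕ => ((m * n : ℕ) : ℝ) ≤ x),
            (SieveSequence.fiGamma C n : ℝ) * (μ (m * n) : ℝ) * A.a (m * n)| ≤
          K * A.size x / Real.log x ^ k := by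
  obtain ⟨K₆, h16⟩ := h.2.2.1
  have hR1 := h.2.2.2.2.2.2.1
  have hB := h.2.2.2.2.2.2.2.2
  set C₁ : ℝ := 2 ^ 12 * max K₆ 0 * Real.exp (2 ^ 22) with hC₁
  have hC₁0 : 0 ≤ C₁ := by positivity
  refine ⟨C₁ + 1, ?_⟩
  filter_upwards [h16, hR1, hB, eventually_ge_atTop (8 : ℝ)] with x h16x hR1x hBx hx8 N hN1 hN2 C hC1 hC2
  classical
  -- basics at `x`
  have hx1 : (1 : ℝ) < x := by linarith
  set L : ℝ := Real.log x with hLdef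
  have hL1 : 1 ≤ L := by
    rw [hLdef, ← Real.log_exp 1]
    refine Real.log_le_log (Real.exp_pos 1) ?_
    have := Real.exp_one_lt_d9
    linarith
  have hL0 : 0 < L := by linarith
  have hA0 : 0 ≤ A.size x := by rw [h.size_eq]; exact A.congrSum_nonneg 1 x
  set M := Icc 1 ⌊x⌋₊ with hMdef
  set F : ℕ → Finset ℕ := fun m =>
    (Ioc ⌊N⌋₊ ⌊2 * N⌋₊).filter (fun n : ℕ => ((m * n : ℕ) : ℝ) ≤ x) with hFdef
  set I : ℕ → ℝ := fun m =>
    ∑ n ∈ F m, (SieveSequence.fiGamma C n : ℝ) * (μ (m * n) : ℝ) * A.a (m * n) with hIdef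
  -- (B)
  have hB0 : ∑ m ∈ M, |I m| ≤ A.size x * L ^ (-(2 ^ 22 : ℝ)) := by
    have h0 := hBx N hN1 hN2 C hC1 hC2
    rw [SieveSequence.fiBilinear] at h0
    rw [Real.rpow_neg hL0.le, ← div_eq_mul_inv]
    convert h0 using 2
    rw [SieveSequence.fiLogSaving, ← Real.rpow_natCast]
    norm_num
  -- only squarefree `m` contribute
  set Ms := M.filter Squarefree with hMsdef
  have hI0 : ∀ m ∈ M, ¬Squarefree m → I m = 0 := by
    intro m _ hm
    refine Finset.sum_eq_zero fun n _ => ?_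
    have : ¬Squarefree (m * n) := fun hmn => hm (Squarefree.of_mul_left hmn)
    rw [h.a_eq_zero this, mul_zero]
  have hsplit : ∑ m ∈ M, (divisorCountK 5 m : ℝ) * |I m| = ∑ m ∈ Ms, (divisorCountK 5 m : ℝ) * |I m| := by
    rw [hMsdef, Finset.sum_filter]
    refine Finset.sum_congr rfl fun m hm => ?_
    split_ifs with hsq
    · rfl
    · rw [hI0 m hm hsq, abs_zero, mul_zero]
  have hMs : ∀ m ∈ Ms, Squarefree m := fun m hm => (Finset.mem_filter.mp hm).2
  -- `R₀`
  have hR0 : ∑ m ∈ Ms, |I m| ≤ A.size x * L ^ (-(2 ^ 22 : ℝ)) :=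
    le_trans (Finset.sum_le_sum_of_subset_of_nonneg (Finset.filter_subset _ _)
      fun m _ _ => abs_nonneg _) hB0
  -- `R₁`
  have hR1' : ∑ m ∈ Ms, (9 : ℝ) ^ m.primeFactors.card * |I m| ≤ C₁ * A.size x * L ^ (2 ^ 20 : ℝ) := by
    have hIle : ∀ m, |I m| ≤ ∑ n ∈ F m, ((n.divisors.card : ℝ)) * A.a (m * n) := by
      intro m
      refine (Finset.abs_sum_le_sum_abs _ _).trans (Finset.sum_le_sum fun n _ => ?_)
      rw [abs_mul, abs_mul, abs_of_nonneg (A.a_nonneg _)]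
      have hγ : |(SieveSequence.fiGamma C n : ℝ)| ≤ (n.divisors.card : ℝ) := by
        have := SieveSequence.abs_fiGamma_le C n
        rw [ArithmeticFunction.sigma_zero_apply] at this
        exact_mod_cast this
      have hμ : |(μ (m * n) : ℝ)| ≤ 1 := by exact_mod_cast ArithmeticFunction.abs_moebius_le_one
      calc |(SieveSequence.fiGamma C n : ℝ)| * |(μ (m * n) : ℝ)| * A.a (m * n)
          ≤ (n.divisors.card : ℝ) * 1 * A.a (m * n) := by gcongr; exact A.a_nonneg _
        _ = (n.divisors.card : ℝ) * A.a (m * n) := by ring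
    calc ∑ m ∈ Ms, (9 : ℝ) ^ m.primeFactors.card * |I m|
        ≤ ∑ m ∈ M, (9 : ℝ) ^ m.primeFactors.card * |I m| :=
          Finset.sum_le_sum_of_subset_of_nonneg (Finset.filter_subset _ _)
            fun m _ _ => mul_nonneg (by positivity) (abs_nonneg _)
      _ ≤ ∑ m ∈ M, ∑ n ∈ F m, (9 : ℝ) ^ m.primeFactors.card * ((n.divisors.card : ℝ)) * A.a (m * n) := by
          refine Finset.sum_le_sum fun m _ => ?_
          rw [show ∑ n ∈ F m, (9 : ℝ) ^ m.primeFactors.card * ((n.divisors.card : ℝ)) * A.a (m * n) =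
            (9 : ℝ) ^ m.primeFactors.card * ∑ n ∈ F m, ((n.divisors.card : ℝ)) * A.a (m * n) by
            rw [Finset.mul_sum]; refine Finset.sum_congr rfl fun n _ => by ring]
          exact mul_le_mul_of_nonneg_left (hIle m) (by positivity)
      _ ≤ ∑ k ∈ Ioc 0 ⌊x⌋₊, ∑ p ∈ k.divisorsAntidiagonal,
            (9 : ℝ) ^ p.1.primeFactors.card * ((p.2.divisors.card : ℝ)) * A.a (p.1 * p.2) := by
          refine sum_sum_le_sum_divisorsAntidiagonal (f := fun m n =>
            (9 : ℝ) ^ m.primeFactors.card * ((n.divisors.card : ℝ)) * A.a (m * n))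
            (fun m n => mul_nonneg (by positivity) (A.a_nonneg _)) ⌊x⌋₊ M F fun m hm n hn => ?_
          obtain ⟨hm1, -⟩ := Finset.mem_Icc.mp hm
          obtain ⟨hn1, hn2⟩ := Finset.mem_filter.mp hn
          refine ⟨hm1, Nat.succ_le_of_lt (lt_of_le_of_lt (Nat.zero_le _) (Finset.mem_Ioc.mp hn1).1), ?_⟩
          exact Nat.le_floor hn2
      _ = ∑ k ∈ Ioc 0 ⌊x⌋₊, A.a k * ∑ p ∈ k.divisorsAntidiagonal,
            (9 : ℝ) ^ p.1.primeFactors.card * ((p.2.divisors.card : ℝ)) := by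
          refine Finset.sum_congr rfl fun k _ => ?_
          rw [Finset.mul_sum]
          refine Finset.sum_congr rfl fun p hp => ?_
          rw [(Nat.mem_divisorsAntidiagonal.mp hp).1]
          ring
      _ ≤ ∑ k ∈ Ioc 0 ⌊x⌋₊, A.a k * ((k.divisors.card : ℝ)) ^ 4 := by
          refine Finset.sum_le_sum fun k _ => ?_
          by_cases hsq : Squarefree k
          · exact mul_le_mul_of_nonneg_left
              (sum_divisorsAntidiagonal_nine_pow_mul_card_divisors_le hsq) (A.a_nonneg k)
          · rw [h.a_eq_zero hsq, zero_mul, zero_mul]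
      _ ≤ C₁ * A.size x * L ^ (2 ^ 20 : ℝ) := h.sum_a_mul_card_divisors_pow_four_le hx8 h16x
  -- Hölder and the numerical tail
  have hH := SieveSequence.sum_divisorCountK_five_mul_le_holder Ms hMs (r := fun m => |I m|)
    (fun m _ => abs_nonneg _)
  rw [hsplit]
  refine hH.trans ?_
  exact holder_tail_le_pow hk hA0 hL1 hC₁0 (Finset.sum_nonneg fun m _ => abs_nonneg _)
    (Finset.sum_nonneg fun m _ => mul_nonneg (by positivity) (abs_nonneg _)) hR0 hR1'

end Literature.NumberTheory.Sieve
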